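import Mathlib
import Literature.AlgebraicGeometry.Resolution.CobordantGame
import Literature.AlgebraicGeometry.Resolution.PointBlowupFlagInvariant
import Summits.ResolutionOfSingularities.ResolutionOfSingularities.Theorems.WeightedInvariantLocalWeightedDropInsepStateLift
import Summits.ResolutionOfSingularities.ResolutionOfSingularities.Theorems.WeightedInvariantLocalWeightedDropInsepCleaning
import Summits.ResolutionOfSingularities.ResolutionOfSingularities.Theorems.WeightedInvariantLocalWeightedDropMonicDoublePointLiftReduced

/-!
# `WeightedInvariant.LocalWeightedDrop`, line `hasse-ridge-face-selection`: the INSEP state-rank bridge with the SQUARES REMOVED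
# from the rank player's duty (repair of the closing form of S2iM)

Crux item stmt-ResolutionOfSingularities-8899 `LocalWeightedDrop` (route `ResolutionOfSingularities/WeightedInvariant`),
serving the door `WeightedConstruction` stmt-ResolutionOfSingularities-0571.  [OURS · L1 W4.3, chain w43, unit res-L1-w43-stub-8
(seat res-D-pv-006): piece M7a of the S2iM plan (L/res-L1-w43-stub-3/S2iM-ATTACK-PLAN.md); NOT a statement of any manuscript.]

The state-carrying lift `insepWon_of_stateRank` (p485441) asks the rank player for a strict drop at EVERY position `A₀` with
`ord A₀ > 2` outside the exit class `T`.  With `T` = the TERMINAL class of S2iT this duty is unsatisfiable: the positions contain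
`0` and every square `r²` (`ord r ≥ 2`), no square is terminal, and each of the five step options from a square (cleaning
`A₀ + φ²`, a formal change of `x₀, x₁`, the cleaned point-step successors, the cleaned curve-step successors) produces squares only —
exactly as for the non-reduced double planes of N4″ (`…MonicDoublePointLiftReduced`).  In the full game these positions are won
OUTRIGHT: `y² + r² = (y + r)²` is re-centred to `y²`, a monomial (`MonicDoublePointLiftReduced.won_monic_two_sq`, characteristic
`2` kills the linear term).  This file records the repaired closing form of S2iM:

* `won_dp_sq` — `y² + r²` is won (`r(0) = 0`, characteristic `2`);
* `won_dp_of_cleanSeries_eq_zero` — a position whose cleaning vanishes is won (`k` algebraically closed: it is a square);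
* `charTwoInseparableReductionWon_of_insepStateRankReduced` — the v21–v28 stub `stub_charTwoInseparableReductionWon` VERBATIM from
  the existence, over every algebraically closed field of characteristic `2`, of `(S, s₀, κ)` with the step property of
  `insepWon_of_stateRank` demanded ONLY at positions `A₀` with `cleanSeries 2 A₀ ≠ 0`, relative to the enlarged exit class
  «`ord B > 2` and (`B` terminal, or `cleanSeries 2 B` terminal, or `cleanSeries 2 B = 0`)».
-/

set_option linter.dupNamespace false -- mandated namespace of this single-conjunct summit

namespace Summit.ResolutionOfSingularities.ResolutionOfSingularities.Theorems

open Literature.AlgebraicGeometry.Resolution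
open Literature.AlgebraicGeometry.Resolution.CobordantGame
open Literature.AlgebraicGeometry.Resolution.HauserPerlega2024 (cleanSeries)

namespace InsepReduced

open MvPowerSeries InsepCleaning

variable {k : Type} [Field k]

/-- In characteristic `2` the constant `2` of `k[[x]]` vanishes. -/
theorem two_eq_zero [CharP k 2] {σ : Type} : (2 : MvPowerSeries σ k) = 0 := by
  rw [← map_ofNat (C (σ := σ) (R := k)) 2, CharTwo.two_eq_zero, map_zero]

/-- `y² + r² = (y + r)²` IS WON (`r(0) = 0`, characteristic `2`): re-centre to the monomial `y²`
(`MonicDoublePointLiftReduced.won_monic_two_sq` with the linear term `2r = 0`). -/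
theorem won_dp_sq [CharP k 2] (r : MvPowerSeries (Fin 2) k) (hr : constantCoeff r = 0) :
    Won k 3 (X (Fin.last 2) ^ 2 + rename (Fin.succAboveEmb (Fin.last 2)) (r ^ 2)) := by
  have h := MonicDoublePointLiftReduced.won_monic_two_sq (k := k) (m := 2) r hr
  rwa [two_eq_zero, zero_mul, map_zero, zero_mul, add_zero] at h

/-- A position whose cleaning VANISHES is a square, hence won (`k` algebraically closed of characteristic `2`, `A₀(0) = 0`). -/
theorem won_dp_of_cleanSeries_eq_zero [CharP k 2] [IsAlgClosed k] (A₀ : MvPowerSeries (Fin 2) k)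
    (h0 : constantCoeff A₀ = 0) (hc : cleanSeries 2 A₀ = 0) :
    Won k 3 (X (Fin.last 2) ^ 2 + rename (Fin.succAboveEmb (Fin.last 2)) A₀) := by
  obtain ⟨φ, hφ0, heq⟩ := exists_cleanSeries_two_eq_add_sq A₀
  rw [h0, sq_eq_zero_iff] at hφ0
  have hA : A₀ = φ ^ 2 := by
    have h := heq
    rw [hc, eq_comm, add_eq_zero_iff_eq_neg] at h
    rw [h, neg_eq_iff_add_eq_zero, ← two_mul, two_eq_zero, zero_mul]
  rw [hA]
  exact won_dp_sq φ hφ0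

/-- `ord B > 2` forces `B(0) = 0`. -/
theorem constantCoeff_eq_zero_of_two_lt_order {B : MvPowerSeries (Fin 2) k} (h : (2 : ℕ∞) < B.order) :
    constantCoeff B = 0 := by
  rw [← coeff_zero_eq_constantCoeff_apply]
  exact coeff_of_lt_order (lt_trans (by simp) h)

end InsepReduced

open InsepReduced InsepCleaning InsepDoublePoint TerminalDoublePoint MvPowerSeries in
/-- S2iM FROM A STATE-CARRYING RANK ON THE NON-SQUARE POSITIONS (the v21–v28 stub `stub_charTwoInseparableReductionWon` VERBATIM as
conclusion; repaired closing form).  Suppose that over every algebraically closed field `k` of characteristic `2` there are a state type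
`S`, an initial state `s₀` and a rank `κ : S → k[[x₀,x₁]] → Ordinal` such that from every state `s` and every position `A₀` with
`ord A₀ > 2` whose cleaning `cleanSeries 2 A₀` is NON-ZERO, the rank player has one of the five options of `insepWon_of_stateRank`
— exit, a cleaning `A₀ + φ²`, a formal change of `x₀, x₁`, the point blow-up (all cleaned chart successors), a permissible curve blow-up
`V(x_i, y)` — every resulting position `B` lying in the exit class «`ord B > 2` and (`B` terminal, or `cleanSeries 2 B` terminal, or
`cleanSeries 2 B = 0`)» or having smaller rank in some new state.  Then, given the singular germs in `≤ 2` variables and the terminal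
double points, every `y² + A₀` with `ord A₀ > 2` is won.  (Squares are won outright: `won_dp_of_cleanSeries_eq_zero`.)
[OURS · L1 W4.3, M7a] -/
theorem charTwoInseparableReductionWon_of_insepStateRankReduced
    (hrank : ∀ (k : Type) [Field k] [CharP k 2] [IsAlgClosed k],
      ∃ (S : Type) (_ : S) (κ : S → MvPowerSeries (Fin 2) k → Ordinal.{0}),
      ∀ (s : S) (A₀ : MvPowerSeries (Fin 2) k), (2 : ℕ∞) < A₀.order → cleanSeries 2 A₀ ≠ 0 →
      let T : MvPowerSeries (Fin 2) k → Prop := fun B => (2 : ℕ∞) < B.order ∧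
        (((∃ (r s : ℕ) (U : MvPowerSeries (Fin 2) k), constantCoeff U ≠ 0 ∧ ¬ (2 ∣ r ∧ 2 ∣ s) ∧
              B = X (0 : Fin 2) ^ r * X (1 : Fin 2) ^ s * U) ∨
            (∃ (i : Fin 2) (m : ℕ) (g : MvPowerSeries (Fin 2) k), 0 < m ∧ g.order = 1 ∧ B = X i ^ (2 * m) * g)) ∨
          ((∃ (r s : ℕ) (U : MvPowerSeries (Fin 2) k), constantCoeff U ≠ 0 ∧ ¬ (2 ∣ r ∧ 2 ∣ s) ∧
              cleanSeries 2 B = X (0 : Fin 2) ^ r * X (1 : Fin 2) ^ s * U) ∨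
            (∃ (i : Fin 2) (m : ℕ) (g : MvPowerSeries (Fin 2) k), 0 < m ∧ g.order = 1 ∧
              cleanSeries 2 B = X i ^ (2 * m) * g)) ∨
          cleanSeries 2 B = 0)
      T A₀ ∨
      (∃ φ : MvPowerSeries (Fin 2) k, constantCoeff φ = 0 ∧ (2 : ℕ∞) < (A₀ + φ ^ 2).order ∧
        (T (A₀ + φ ^ 2) ∨ ∃ s' : S, κ s' (A₀ + φ ^ 2) < κ s A₀)) ∨
      (∃ θ : Fin 2 → MvPowerSeries (Fin 2) k, (∀ i, constantCoeff (θ i) = 0) ∧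
        IsUnit (Matrix.det (Matrix.of fun i j => coeff (Finsupp.single j 1) (θ i))) ∧
        (T (subst θ A₀) ∨ ∃ s' : S, κ s' (subst θ A₀) < κ s A₀)) ∨
      (∀ (c : Fin 2 → k) (i₀ : Fin 2), c i₀ ≠ 0 → ∀ (A' : MvPowerSeries (Fin 2) k) (α β : k),
        subst (fun l : Fin 2 => if l = i₀ then C (c i₀) * X 0 else
          X 0 * (C (c l) + (X 1 : MvPowerSeries (Fin 2) k))) A₀ = X 0 ^ 2 * A' →
        α ^ 2 = coeff (Finsupp.single 0 2) A' → β ^ 2 = coeff (Finsupp.single 1 2) A' →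
        (2 : ℕ∞) < (A' + (C α * X 0 + C β * X 1) ^ 2).order →
        T (A' + (C α * X 0 + C β * X 1) ^ 2) ∨ ∃ s' : S, κ s' (A' + (C α * X 0 + C β * X 1) ^ 2) < κ s A₀) ∨
      (∃ (i : Fin 2) (A₀' : MvPowerSeries (Fin 2) k), A₀ = X i ^ 2 * A₀' ∧ constantCoeff A₀' = 0 ∧
        ∀ c : k, c ≠ 0 → ∀ (A' : MvPowerSeries (Fin 2) k) (α β : k),
        A' = C (c ^ 2) * subst (fun l : Fin 2 => if l = i then C c * X 0 else (X 1 : MvPowerSeries (Fin 2) k)) A₀' →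
        α ^ 2 = coeff (Finsupp.single 0 2) A' → β ^ 2 = coeff (Finsupp.single 1 2) A' →
        (2 : ℕ∞) < (A' + (C α * X 0 + C β * X 1) ^ 2).order →
        T (A' + (C α * X 0 + C β * X 1) ^ 2) ∨ ∃ s' : S, κ s' (A' + (C α * X 0 + C β * X 1) ^ 2) < κ s A₀)) :
    ∀ (k : Type) [Field k] [CharP k 2] [IsAlgClosed k],
      (∀ m : ℕ, m < 3 → ∀ g : MvPowerSeries (Fin m) k,
        CobordantGame.IsSingular k g → CobordantGame.Won k m g) →
      (∀ (A₀ : MvPowerSeries (Fin 2) k), (2 : ℕ∞) < A₀.order →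
        ((∃ (r s : ℕ) (U : MvPowerSeries (Fin 2) k), MvPowerSeries.constantCoeff U ≠ 0 ∧ ¬ (2 ∣ r ∧ 2 ∣ s) ∧
            A₀ = MvPowerSeries.X (0 : Fin 2) ^ r * MvPowerSeries.X (1 : Fin 2) ^ s * U) ∨
          (∃ (i : Fin 2) (m : ℕ) (g : MvPowerSeries (Fin 2) k), 0 < m ∧ g.order = 1 ∧
            A₀ = MvPowerSeries.X i ^ (2 * m) * g)) →
        CobordantGame.Won k 3 (MvPowerSeries.X (Fin.last 2) ^ 2 +
          MvPowerSeries.rename (Fin.succAboveEmb (Fin.last 2)) A₀)) →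
      ∀ (A₀ : MvPowerSeries (Fin 2) k), (2 : ℕ∞) < A₀.order →
        CobordantGame.Won k 3 (MvPowerSeries.X (Fin.last 2) ^ 2 +
          MvPowerSeries.rename (Fin.succAboveEmb (Fin.last 2)) A₀) := by
  intro k _ _ _ hlow hterm A₀ hA₀
  obtain ⟨S, s₀, κ, hκ⟩ := hrank k
  -- the enlarged exit class
  let T : MvPowerSeries (Fin 2) k → Prop := fun B => (2 : ℕ∞) < B.order ∧
    (((∃ (r s : ℕ) (U : MvPowerSeries (Fin 2) k), constantCoeff U ≠ 0 ∧ ¬ (2 ∣ r ∧ 2 ∣ s) ∧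
          B = X (0 : Fin 2) ^ r * X (1 : Fin 2) ^ s * U) ∨
        (∃ (i : Fin 2) (m : ℕ) (g : MvPowerSeries (Fin 2) k), 0 < m ∧ g.order = 1 ∧ B = X i ^ (2 * m) * g)) ∨
      ((∃ (r s : ℕ) (U : MvPowerSeries (Fin 2) k), constantCoeff U ≠ 0 ∧ ¬ (2 ∣ r ∧ 2 ∣ s) ∧
          cleanSeries 2 B = X (0 : Fin 2) ^ r * X (1 : Fin 2) ^ s * U) ∨
        (∃ (i : Fin 2) (m : ℕ) (g : MvPowerSeries (Fin 2) k), 0 < m ∧ g.order = 1 ∧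
          cleanSeries 2 B = X i ^ (2 * m) * g)) ∨
      cleanSeries 2 B = 0)
  have hT : ∀ B : MvPowerSeries (Fin 2) k, T B →
      Won k 3 (X (Fin.last 2) ^ 2 + rename (Fin.succAboveEmb (Fin.last 2)) B) := by
    rintro B ⟨hB, hlit | hclean | hsq⟩
    · exact hterm B hB hlit
    · have h0 := constantCoeff_eq_zero_of_two_lt_order hB
      exact (won_dp_cleanSeries_iff k B h0).mp (hterm _ (two_lt_order_cleanSeries B hB) hclean)
    · exact won_dp_of_cleanSeries_eq_zero B (constantCoeff_eq_zero_of_two_lt_order hB) hsq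
  refine insepWon_of_stateRank k (hlow 1 (by norm_num)) T hT κ ?_ s₀ A₀ hA₀
  intro s B hB
  by_cases hc : cleanSeries 2 B = 0
  · exact Or.inl ⟨hB, Or.inr (Or.inr hc)⟩
  · exact hκ s B hB hc

end Summit.ResolutionOfSingularities.ResolutionOfSingularities.Theorems
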